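import Literature.NumberTheory.LFunctions.FordIncompleteS3
import HarnessLib

/-!
# Ford's Lemma 4.1, case `S₃`: reduction of the class `S₃` to the auxiliary count

Topic `Literature/NumberTheory/LFunctions`. Everything here is PROVED.

The solutions of (4.1) (heads injective) in which some rest variable `x_i` or `y_i` is special are
at most `2m` times the number `N₃` of solutions with `x_s` special (symmetries), and
`N₃ ≤ S3count` (write `x_s = d·w'` with the least admissible `d`).
[K. Ford, Proc. LMS 85 (2002), proof of Lemma 4.1, case S₃.]

## References

* K. Ford, Proc. London Math. Soc. (3) 85 (2002), 565–633, proof of Lemma 4.1 (case S₃).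
  [Ford2002]
-/

noncomputable section

open Finset
open scoped Real

namespace Literature.NumberTheory.LFunctions
namespace FordVK

open VMV FordSmooth

/-! ### Divisors of smooth numbers -/

/-- A divisor `d ≤ Q'` of a member of `𝒞(P,R)` lies in `𝒞(Q',R)`. [folklore] -/
theorem dvd_mem_smoothSet {P Q' R : ℝ} {w d : ℕ} (hw : w ∈ smoothSet P R) (hd : d ∣ w)
    (hdQ : (d : ℝ) ≤ Q') : d ∈ smoothSet Q' R := by
  rw [mem_smoothSet] at hw ⊢
  have hw0 : w ≠ 0 := by omega
  have hd0 : d ≠ 0 := fun h0 => hw0 (by rw [h0] at hd; exact zero_dvd_iff.1 hd)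
  refine ⟨Nat.pos_of_ne_zero hd0, hdQ, fun p hp => hw.2.2 p ?_⟩
  exact Nat.primeFactors_mono hd hw0 hp

/-- A divisor of a member of `𝒞(P,R)` lies in `𝒞(P,R)`. [folklore] -/
theorem dvd_mem_smoothSet_self {P R : ℝ} {w d : ℕ} (hw : w ∈ smoothSet P R) (hd : d ∣ w) :
    d ∈ smoothSet P R := by
  have hw' := mem_smoothSet.1 hw
  refine dvd_mem_smoothSet hw hd (le_trans ?_ hw'.2.1)
  exact_mod_cast Nat.le_of_dvd (by omega) hd

/-! ### The injection `N₃ ≤ S3count` -/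

section Inject

variable {k h g t m' : ℕ} {P Q R : ℝ}

/-- The least admissible divisor of a special `w`. [folklore] -/
def dsel (Qn J w : ℕ) (hs : Special Qn J w) : ℕ :=
  (w.divisors.filter fun d => d ≤ Qn ∧ rad (w / d) ∣ J).min' (by
    obtain ⟨d, hd, h1, h2⟩ := hs
    exact ⟨d, mem_filter.2 ⟨hd, h1, h2⟩⟩)

/-- Properties of `dsel`. [folklore] -/
theorem dsel_spec (Qn J w : ℕ) (hs : Special Qn J w) :
    dsel Qn J w hs ∈ w.divisors ∧ dsel Qn J w hs ≤ Qn ∧ rad (w / dsel Qn J w hs) ∣ J := by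
  have := Finset.min'_mem (w.divisors.filter fun d => d ≤ Qn ∧ rad (w / d) ∣ J) (by
    obtain ⟨d, hd, h1, h2⟩ := hs
    exact ⟨d, mem_filter.2 ⟨hd, h1, h2⟩⟩)
  rw [mem_filter] at this
  exact ⟨this.1, this.2.1, this.2.2⟩

/-- `s(r) = s(init r) + ν(r_last)`. [folklore] -/
theorem psvR_eq_init_add_last (r : Fin (m' + 1) → ℤ) :
    psvR k h g r = psvR k h g (Fin.init r) + nuR k h g (r (Fin.last m')) := by
  rw [psvR_eq_sum_nuR, psvR_eq_sum_nuR, Fin.sum_univ_castSucc]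
  rfl

variable (k h g t m')

/-- `N₃`: solutions with injective head `x` whose last rest variable is special w.r.t. `J*(x)`.
[cite: Ford2002, proof of Lemma 4.1 (case S₃, the sum `H(α)`)] -/
def N3count (B : Finset ℤ) (Qn : ℕ) : ℕ :=
  ((SolS k h g t (m' + 1) B).filter fun p =>
    Function.Injective p.1.1 ∧ Special Qn (JN p.1.1) (p.1.2 (Fin.last m')).natAbs).card

variable {k h g t m'}

/-- **`N₃ ≤ S3count`**: write the special variable as `d·w'` with the least admissible `d`.
[cite: Ford2002, proof of Lemma 4.1 (case S₃: "the integral on the right is the number of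
solutions of …")] -/
theorem N3count_le_S3count (hQ : 0 ≤ Q) :
    N3count k h g t m' ((smoothSet P R).map Nat.castEmbedding) ⌊Q⌋₊
      ≤ S3count k h g t m' ((smoothSet P R).map Nat.castEmbedding) (smoothSet P R) (smoothSet Q R) ⌊P⌋₊ := by
  classical
  set C := smoothSet P R with hC
  set B : Finset ℤ := C.map Nat.castEmbedding with hB
  set D := smoothSet Q R with hD
  have hBmem : ∀ z : ℤ, z ∈ B ↔ ∃ n ∈ C, (n : ℤ) = z := by
    intro z; rw [hB, mem_map]; rfl
  have hBpos : ∀ z ∈ B, 1 ≤ z := by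
    intro z hz; obtain ⟨n, hn, rfl⟩ := (hBmem z).1 hz
    exact_mod_cast (mem_smoothSet.1 hn).1
  -- the map
  unfold N3count S3count
  set F := (SolS k h g t (m' + 1) B).filter fun p =>
    Function.Injective p.1.1 ∧ Special ⌊Q⌋₊ (JN p.1.1) (p.1.2 (Fin.last m')).natAbs with hF
  -- a (noncanonical-looking but definite) choice of `d`
  let dOf : (((Fin t → ℤ) × (Fin (m' + 1) → ℤ)) × ((Fin t → ℤ) × (Fin (m' + 1) → ℤ))) → ℕ := fun p =>
    if hs : Special ⌊Q⌋₊ (JN p.1.1) (p.1.2 (Fin.last m')).natAbs then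
      dsel ⌊Q⌋₊ (JN p.1.1) (p.1.2 (Fin.last m')).natAbs hs else 1
  let Ψ : (((Fin t → ℤ) × (Fin (m' + 1) → ℤ)) × ((Fin t → ℤ) × (Fin (m' + 1) → ℤ))) →
      (((Fin t → ℤ) × (ℕ × ℕ)) × (Fin m' → ℤ)) × ((Fin t → ℤ) × (Fin (m' + 1) → ℤ)) := fun p =>
    (((p.1.1, (dOf p, (p.1.2 (Fin.last m')).natAbs / dOf p)), Fin.init p.1.2), p.2)
  have hdOf : ∀ p ∈ F, dOf p ∈ ((p.1.2 (Fin.last m')).natAbs).divisors ∧ dOf p ≤ ⌊Q⌋₊ ∧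
      rad ((p.1.2 (Fin.last m')).natAbs / dOf p) ∣ JN p.1.1 := by
    intro p hp
    rw [hF, mem_filter] at hp
    have hs := hp.2.2
    simp only [dOf, dif_pos hs]
    exact dsel_spec _ _ _ hs
  refine card_le_card_of_injOn Ψ (fun p hp => ?_) ?_
  · -- `Ψ p` lies in the target
    have hp' := hp
    rw [mem_coe, hF, mem_filter, mem_SolS] at hp'
    obtain ⟨⟨⟨hx, hr⟩, ⟨hy, hr'⟩, heq⟩, hinj, hs⟩ := hp'
    obtain ⟨hdiv, hdQ, hrad⟩ := hdOf p hp
    set w : ℕ := (p.1.2 (Fin.last m')).natAbs with hw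
    set d : ℕ := dOf p with hd
    have hwB : p.1.2 (Fin.last m') ∈ B := (mem_tuples.1 hr) _
    obtain ⟨n, hnC, hn⟩ := (hBmem _).1 hwB
    have hwn : w = n := by rw [hw, ← hn, Int.natAbs_natCast]
    have hwC : w ∈ C := hwn ▸ hnC
    have hw0 : w ≠ 0 := by have := (mem_smoothSet.1 hwC).1; omega
    have hdw : d ∣ w := Nat.dvd_of_mem_divisors hdiv
    have hdpos : 0 < d := Nat.pos_of_mem_divisors hdiv
    rw [mem_coe, mem_filter, mem_product, mem_product, mem_product]
    refine ⟨⟨⟨?_, ?_⟩, hy, hr'⟩, ?_⟩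
    · -- `(x, (d, w/d)) ∈ XDW`
      show (p.1.1, (d, w / d)) ∈ XDW t B C D ⌊P⌋₊
      rw [XDW, mem_filter, mem_product, mem_product]
      refine ⟨⟨mem_filter.2 ⟨hx, hinj⟩, ?_, ?_⟩, ?_, hrad⟩
      · exact dvd_mem_smoothSet hwC hdw ((show (d : ℝ) ≤ ⌊Q⌋₊ by exact_mod_cast hdQ).trans (Nat.floor_le hQ))
      · exact dvd_mem_smoothSet_self hwC (Nat.div_dvd_of_dvd hdw)
      · show d * (w / d) ≤ ⌊P⌋₊
        rw [Nat.mul_div_cancel' hdw]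
        exact Nat.le_floor (mem_smoothSet.1 hwC).2.1
    · show Fin.init p.1.2 ∈ tuples m' B
      rw [mem_tuples]; intro i; exact (mem_tuples.1 hr) _
    · -- the equation
      show vXDW k h g t (p.1.1, (d, w / d)) + psvR k h g (Fin.init p.1.2) = psvR k h g p.2.1 + psvR k h g p.2.2
      rw [← heq, vXDW, psvR_eq_init_add_last p.1.2]
      simp only
      rw [Nat.mul_div_cancel' hdw]
      have hlast : ((w : ℕ) : ℤ) = p.1.2 (Fin.last m') := by
        rw [hw]; exact Int.natAbs_of_nonneg (by linarith [hBpos _ hwB])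
      rw [hlast]; abel
  · -- injectivity
    intro p hp q hq hpq
    simp only [Ψ, Prod.mk.injEq] at hpq
    obtain ⟨⟨⟨hx, hd, hwd⟩, hinit⟩, h2⟩ := hpq
    have hp' := hp; have hq' := hq
    rw [mem_coe, hF, mem_filter, mem_SolS] at hp' hq'
    obtain ⟨hdivp, -, -⟩ := hdOf p hp
    obtain ⟨hdivq, -, -⟩ := hdOf q hq
    have hdwp := Nat.dvd_of_mem_divisors hdivp
    have hdwq := Nat.dvd_of_mem_divisors hdivq
    have hlast : (p.1.2 (Fin.last m')).natAbs = (q.1.2 (Fin.last m')).natAbs := by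
      have e1 := Nat.mul_div_cancel' hdwp
      have e2 := Nat.mul_div_cancel' hdwq
      rw [← e1, ← e2, hwd, hd]
    have hlastZ : p.1.2 (Fin.last m') = q.1.2 (Fin.last m') := by
      have h1 : 1 ≤ p.1.2 (Fin.last m') := hBpos _ ((mem_tuples.1 hp'.1.1.2) _)
      have h2 : 1 ≤ q.1.2 (Fin.last m') := hBpos _ ((mem_tuples.1 hq'.1.1.2) _)
      have := congrArg (fun n : ℕ => (n : ℤ)) hlast
      rwa [Int.natAbs_of_nonneg (by linarith), Int.natAbs_of_nonneg (by linarith)] at this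
    have hr : p.1.2 = q.1.2 := by
      rw [← Fin.snoc_init_self p.1.2, ← Fin.snoc_init_self q.1.2, hinit, hlastZ]
    exact Prod.ext (Prod.ext hx hr) h2

end Inject

/-! ### Symmetries of `SolS` and the bound for the class `S₃` -/

section Symm

variable {k h g t m : ℕ} {B : Finset ℤ}

/-- Swapping the two sides is a symmetry of the solution set. [folklore] -/
theorem card_SolS_filter_swap (Pp : ((Fin t → ℤ) × (Fin m → ℤ)) × ((Fin t → ℤ) × (Fin m → ℤ)) → Prop)
    [DecidablePred Pp] :
    ((SolS k h g t m B).filter fun p => Pp (p.2, p.1)).card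
      = ((SolS k h g t m B).filter fun p => Pp p).card := by
  refine card_equiv (Equiv.prodComm _ _) fun p => ?_
  simp only [mem_filter, mem_SolS, Equiv.prodComm_apply, Prod.fst_swap, Prod.snd_swap]
  constructor
  · rintro ⟨⟨h1, h2, h3⟩, h4⟩; exact ⟨⟨h2, h1, h3.symm⟩, h4⟩
  · rintro ⟨⟨h1, h2, h3⟩, h4⟩; exact ⟨⟨h2, h1, h3.symm⟩, h4⟩

/-- Permuting the rest variables of the left side is a symmetry of the solution set. [folklore] -/
theorem card_SolS_filter_perm_rest (σ : Equiv.Perm (Fin m))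
    (Pp : (Fin t → ℤ) → (Fin m → ℤ) → ((Fin t → ℤ) × (Fin m → ℤ)) → Prop)
    [∀ x r q, Decidable (Pp x r q)] :
    ((SolS k h g t m B).filter fun p => Pp p.1.1 (p.1.2 ∘ σ) p.2).card
      = ((SolS k h g t m B).filter fun p => Pp p.1.1 p.1.2 p.2).card := by
  symm
  refine card_equiv (((Equiv.refl _).prodCongr (compPerm σ).symm).prodCongr (Equiv.refl _)) fun p => ?_
  simp only [mem_filter, mem_SolS, Equiv.prodCongr_apply, Prod.map_fst, Prod.map_snd, Equiv.refl_apply]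
  have e1 : ((compPerm σ).symm p.1.2) = p.1.2 ∘ σ.symm := rfl
  rw [e1, comp_perm_mem_tuples, psvR_comp_perm]
  have e2 : (p.1.2 ∘ ⇑σ.symm) ∘ ⇑σ = p.1.2 := by funext i; simp
  rw [e2]

end Symm

section ClassS3

variable (k h g t m' : ℕ) (B : Finset ℤ) (Qn : ℕ)

/-- The class `S₃`: heads injective, some rest variable special. [cite: Ford2002, proof of Lemma 4.1
(definition of S₃)] -/
def SolSp : Finset (((Fin t → ℤ) × (Fin (m' + 1) → ℤ)) × ((Fin t → ℤ) × (Fin (m' + 1) → ℤ))) :=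
  (SolS k h g t (m' + 1) B).filter fun p => Function.Injective p.1.1 ∧ Function.Injective p.2.1 ∧
    ∃ i : Fin (m' + 1), Special Qn (JN p.1.1) (p.1.2 i).natAbs ∨ Special Qn (JN p.2.1) (p.2.2 i).natAbs

variable {k h g t m' B Qn}

/-- **`#S₃ ≤ 2m · N₃`.** [cite: Ford2002, proof of Lemma 4.1 ("S₀ ≤ 4S₃ ≤ 8(s-t) ∫ |H(α) f(α)^{2s-t-1}|")] -/
theorem card_SolSp_le : (SolSp k h g t m' B Qn).card ≤ 2 * (m' + 1) * N3count k h g t m' B Qn := by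
  classical
  -- the sets `A_i` (x-side special at `i`) and `B_i` (y-side special at `i`)
  set A : Fin (m' + 1) → Finset _ := fun i => (SolS k h g t (m' + 1) B).filter fun p =>
    Function.Injective p.1.1 ∧ Special Qn (JN p.1.1) (p.1.2 i).natAbs with hA
  set Bs : Fin (m' + 1) → Finset _ := fun i => (SolS k h g t (m' + 1) B).filter fun p =>
    Function.Injective p.2.1 ∧ Special Qn (JN p.2.1) (p.2.2 i).natAbs with hBs
  have hsub : SolSp k h g t m' B Qn ⊆ (univ : Finset (Fin (m' + 1))).biUnion fun i => A i ∪ Bs i := by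
    intro p hp
    rw [SolSp, mem_filter] at hp
    obtain ⟨hsol, hinjx, hinjy, i, hi⟩ := hp
    rw [mem_biUnion]
    refine ⟨i, mem_univ _, ?_⟩
    rw [mem_union]
    rcases hi with hi | hi
    · left; rw [hA, mem_filter]; exact ⟨hsol, hinjx, hi⟩
    · right; rw [hBs, mem_filter]; exact ⟨hsol, hinjy, hi⟩
  have hAi : ∀ i, (A i).card = N3count k h g t m' B Qn := by
    intro i
    rw [N3count]
    have := card_SolS_filter_perm_rest (k := k) (h := h) (g := g) (t := t) (B := B) (Equiv.swap i (Fin.last m'))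
      (fun (x : Fin t → ℤ) (r : Fin (m' + 1) → ℤ) (_ : (Fin t → ℤ) × (Fin (m' + 1) → ℤ)) =>
        Function.Injective x ∧ Special Qn (JN x) (r (Fin.last m')).natAbs)
    simp only [Function.comp_apply, Equiv.swap_apply_right] at this
    rw [← this]
  have hBi : ∀ i, (Bs i).card = (A i).card := by
    intro i
    rw [hA, hBs]
    exact (card_SolS_filter_swap (k := k) (h := h) (g := g) (B := B)
      (fun p => Function.Injective p.1.1 ∧ Special Qn (JN p.1.1) (p.1.2 i).natAbs)).symm.trans rfl |>.symm
  calc (SolSp k h g t m' B Qn).card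
      ≤ ((univ : Finset (Fin (m' + 1))).biUnion fun i => A i ∪ Bs i).card := card_le_card hsub
    _ ≤ ∑ i, (A i ∪ Bs i).card := card_biUnion_le
    _ ≤ ∑ i, ((A i).card + (Bs i).card) := sum_le_sum fun i _ => card_union_le _ _
    _ = ∑ _i : Fin (m' + 1), 2 * N3count k h g t m' B Qn := sum_congr rfl fun i _ => by
        rw [hBi, hAi]; ring
    _ = 2 * (m' + 1) * N3count k h g t m' B Qn := by
        rw [sum_const, card_univ, Fintype.card_fin, smul_eq_mul]; ring

end ClassS3


end FordVK
end Literature.NumberTheory.LFunctions
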